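import Literature.Analysis.FluidPDE.RusinSverakWeakLimitBlowupFiveLeaves
import HarnessLib

/-!
# Rusin–Šverák, Cor. 4.2 and Cor. 4.3, over the five live leaves of their cone
(weak–strong uniqueness **U** in place of its refuted child **U₁**)

Analysis/FluidPDE proof file (theorems only: no definition, no named fact) for the named facts
`Literature.Analysis.FluidPDE.rusin_sverak_weak_limit_of_singular_points` (**C**;
W. Rusin, V. Šverák, *Minimal initial data for potential Navier–Stokes singularities*,
J. Funct. Anal. 260 (2011) 879–891 = arXiv:0911.0500, **Cor. 4.2**, p. 8),
`Literature.Analysis.FluidPDE.rusin_sverak_weak_limit_blowup` (proof of Cor. 4.3, sentences 2–4),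
`Literature.Analysis.FluidPDE.rusin_sverak_minimal_data_compact` (Cor. 4.3, second clause) and
`Literature.Analysis.FluidPDE.rusin_sverak_minimal_blowup` (Cor. 4.3, first clause = the result
announced in the abstract and §1, question (Q): "If `ρ_max` is finite, does there exist an
initial datum `u₀ ∈ Ḣ^{1/2}` with `‖u₀‖_{Ḣ^{1/2}} = ρ_max`, such that the solution … develops a
singularity in finite time? We will show that the answer to the question is affirmative, see
Corollary 4.3"; `MildSolutions.lean`, ns.S14).

## Why this file

The accepted head assemblies of this cone,
`rusin_sverak_weak_limit_of_singular_points_of_five_leaves` / `leray_theory_inputs_of_five_leaves`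
(`RusinSverakWeakStabilityFiveLeaves.lean`) and `rusin_sverak_weak_limit_blowup_of_five_leaves` /
`rusin_sverak_minimal_data_compact_of_five_leaves` / `rusin_sverak_minimal_blowup_of_five_leaves`
(`RusinSverakWeakLimitBlowupFiveLeaves.lean`), take as their third leaf the difference energy
estimate **U₁** `local_leray_difference_energy_estimate` (Lemarié-Rieusset 2016, proof of
Thm. 14.7), feeding it to `local_leray_weak_strong_uniqueness_of : U₁ → U`. **U₁ is refuted**:
`not_local_leray_difference_energy_estimate` (`LocalLerayWeakStrongNonmeasurableDatum.lean`; the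
transcription quantified over arbitrary, possibly non-measurable data `u₀ : ℝ³ → ℝ³`, whereas the
book's datum is a class in `L²_uloc`). Those five-leaves theorems are therefore vacuous and can
never be instantiated. The parent fact **U** `local_leray_weak_strong_uniqueness`
(`LocalLerayWeakStrong.lean`; Lemarié-Rieusset 2016, **Thm. 14.7**, p. 514, quantified over data in
`E²`, hence measurable) is unaffected — its corrected child is the measurable-datum estimate
written out in `LocalLerayWeakStrongMeasurable.lean`
(`local_leray_weak_strong_uniqueness_of_measurable_datum`) — and **U** is what the glue
`rusin_sverak_weak_limit_of_singular_points_of_local_leray_theory` actually consumes. This file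
records Cor. 4.2 and the three Cor. 4.3 facts over the five **live** leaves

1. **F2** `localEnergySolution_extension_of_memE2` — the extension step for local energy
   solutions with `E²` data (Seregin 2014, App. B §B.5; Lemarié-Rieusset 2016, Thm. 14.8, proof,
   Steps 1–3), `LocalEnergyExtension.lean`;
2. **U** `local_leray_weak_strong_uniqueness` — weak–strong uniqueness for local Leray solutions
   (Lemarié-Rieusset 2016, Thm. 14.7), `LocalLerayWeakStrong.lean`;
3. **J2** `jia_sverak_2013_lemma_2` — the a priori local energy estimate (Jia–Šverák 2013,
   Lemma 2), `JiaSverak2013AprioriEstimate.lean`;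
4. **J8** `jia_sverak_2013_lemma_8` — the uniform initial layer (Jia–Šverák 2013, Lemma 8),
   `JiaSverak2013Compactness.lean`;
5. **Lim** `localLeray_limit_isLocalLeraySolution` — the limit of local Leray solutions is a local
   Leray solution with the weak-limit datum (Jia–Šverák 2013, proof of Thm. 1; Lemarié-Rieusset
   2016, proof of Thm. 15.5), `LocalLerayLimitingProcedure.lean`;

every other input of the printed proofs being a theorem of the tree plugged in here: Kato's local
theory and the local stage of Leray existence for `L³` data
(`leray_solution_exists_of_memLp_three_of_extension`), the local Leray property of Kato solutions
**A** (`kato_isLocalLeraySolutionOn_holds`), Kato's bound **R** (`kato_solution_le_div_sqrt_holds`),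
"finite `T_max` forces a singular point" **N** (`rusin_sverak_singular_point_of_blowup_holds`),
Prop. 2.2, Lemma 2.1, ε-regularity and the CKN inputs (inside
`rusin_sverak_leray_singular_points_stable_of_three_leaves`), the Sobolev embedding
`Ḣ^{1/2} ⊂ L³` and sequential Banach–Alaoglu (inside `rusin_sverak_minimal_blowup_of_singular_points'`).
It also records the one-hypothesis forms over **C** alone (with **N** discharged), which are the
shapes of the final discharges: `rusin_sverak_minimal_blowup_holds` is
`rusin_sverak_minimal_blowup_of_weak_limit_of_singular_points C_holds`, equivalently
`rusin_sverak_minimal_blowup_of_five_leaves'` applied to the five leaf discharges once they exist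
(none does at the time of writing, `lean search`, 2026-08-15).

## Mathlib / tree search

Tree (all used): `rusin_sverak_weak_limit_of_singular_points_of_local_leray_theory`,
`leray_solution_ae_eq_kato_of_local_leray_theory` (`RusinSverakLerayWeakStrong.lean`),
`leray_solution_exists_of_memLp_three_of_extension` (`LocalEnergyExtension.lean`),
`kato_isLocalLeraySolutionOn_holds` (`KatoLocalLerayPressureProofs.lean`),
`kato_solution_le_div_sqrt_holds` (`RusinSverakKatoBoundHolds.lean`),
`rusin_sverak_leray_singular_points_stable_of_three_leaves`
(`RusinSverakSingularPointsStableThreeLeaves.lean`), `rusin_sverak_singular_point_of_blowup_holds`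
(`KatoFarFieldBound.lean`), `rusin_sverak_weak_limit_blowup_of_singular_points'`,
`rusin_sverak_minimal_data_compact_of_singular_points'`,
`rusin_sverak_minimal_blowup_of_singular_points'` (`RusinSverakWeakStabilityProofs.lean`).
Nothing named `*_of_five_leaves'`, `*_of_weak_limit_of_singular_points` in the tree (`lean search`).

## References

* W. Rusin, V. Šverák, J. Funct. Anal. 260 (2011) 879–891 = arXiv:0911.0500: §1 question (Q)
  (p. 2), §4 p. 6 (Leray solutions for `Ḣ^{1/2}` data; "the only reason for `T_max < ∞` is a
  singularity"), Thm. 4.1, Lemma 4.1, Thm. 4.2, Cor. 4.2, Cor. 4.3 and its proof (pp. 6–8).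
  [RusinSverak2011]
* P. G. Lemarié-Rieusset, *The Navier–Stokes Problem in the 21st Century*, CRC Press 2016,
  doi:10.1201/b19556: Thm. 14.7 (p. 514), Thm. 14.8 (pp. 520–527), Thm. 15.1 (p. 565).
  [LemarieRieusset2016]
* H. Jia, V. Šverák, SIAM J. Math. Anal. 45 (2013) 1448–1459 = arXiv:1201.1592: Lemma 2, Cor. 1,
  Lemma 8, proof of Thm. 1. [JiaSverak2013]
-/

noncomputable section

namespace Literature.Analysis.FluidPDE

/-! ## Cor. 4.2 and the Leray-theory inputs over the five live leaves -/

/-- **Rusin–Šverák, Cor. 4.2 (`rusin_sverak_weak_limit_of_singular_points`), over the five live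
leaves of its cone** — the extension step **F2**, weak–strong uniqueness **U** (Lemarié-Rieusset
2016, Thm. 14.7, the parent of the refuted difference estimate **U₁**), Jia–Šverák's Lemma 2 and
Lemma 8, and the identification of the limit of local Leray solutions —, through the accepted glue
`rusin_sverak_weak_limit_of_singular_points_of_local_leray_theory` with **E** from **F2**
(`leray_solution_exists_of_memLp_three_of_extension`), **A** and **R** discharged, and **S** from the
three Jia–Šverák-side leaves (`rusin_sverak_leray_singular_points_stable_of_three_leaves`).
Corrected form of `rusin_sverak_weak_limit_of_singular_points_of_five_leaves` (whose leaf **U₁** is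
refuted, `not_local_leray_difference_energy_estimate`).
[cite: RusinSverak2011, Cor. 4.2 and its proof (arXiv:0911.0500 p. 8), with §4 p. 6 and Thm. 4.1] -/
theorem rusin_sverak_weak_limit_of_singular_points_of_five_leaves'
    (hF2 : localEnergySolution_extension_of_memE2) (hU : local_leray_weak_strong_uniqueness)
    (hJ2 : jia_sverak_2013_lemma_2) (hJ8 : jia_sverak_2013_lemma_8)
    (hLim : localLeray_limit_isLocalLeraySolution) :
    rusin_sverak_weak_limit_of_singular_points :=
  rusin_sverak_weak_limit_of_singular_points_of_local_leray_theory
    (leray_solution_exists_of_memLp_three_of_extension hF2) hU kato_isLocalLeraySolutionOn_holds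
    kato_solution_le_div_sqrt_holds
    (rusin_sverak_leray_singular_points_stable_of_three_leaves hJ2 hJ8 hLim)

/-- The four Leray-theory inputs **E** (`leray_solution_exists_of_memLp_three`), **W**
(`leray_solution_ae_eq_kato`), **R** (`kato_solution_le_div_sqrt`), **S**
(`rusin_sverak_leray_singular_points_stable`) of the accepted glue
`rusin_sverak_weak_limit_of_singular_points_of_leray_theory`, jointly, over the same five live
leaves; corrected form of `leray_theory_inputs_of_five_leaves` (**U** for the refuted **U₁**).
[cite: RusinSverak2011, §4 p. 6, Thm. 4.1, Thm. 4.2 with Lemma 2.1 (arXiv:0911.0500 pp. 6–8)] -/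
theorem leray_theory_inputs_of_five_leaves'
    (hF2 : localEnergySolution_extension_of_memE2) (hU : local_leray_weak_strong_uniqueness)
    (hJ2 : jia_sverak_2013_lemma_2) (hJ8 : jia_sverak_2013_lemma_8)
    (hLim : localLeray_limit_isLocalLeraySolution) :
    leray_solution_exists_of_memLp_three ∧ leray_solution_ae_eq_kato ∧
      kato_solution_le_div_sqrt ∧ rusin_sverak_leray_singular_points_stable :=
  ⟨leray_solution_exists_of_memLp_three_of_extension hF2,
    leray_solution_ae_eq_kato_of_local_leray_theory hU kato_isLocalLeraySolutionOn_holds,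
    kato_solution_le_div_sqrt_holds,
    rusin_sverak_leray_singular_points_stable_of_three_leaves hJ2 hJ8 hLim⟩

/-! ## Cor. 4.3 over Cor. 4.2 alone (N discharged) -/

/-- **Rusin–Šverák's weak-limit blow-up (`rusin_sverak_weak_limit_blowup`, proof of Cor. 4.3,
sentences 2–4) from Cor. 4.2 alone**: `rusin_sverak_weak_limit_blowup_of_singular_points'` with
"finite `T_max` forces a singular point" supplied by its discharge
`rusin_sverak_singular_point_of_blowup_holds`. The discharge `rusin_sverak_weak_limit_blowup_holds`
is this theorem applied to `rusin_sverak_weak_limit_of_singular_points_holds` once it exists.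
[cite: RusinSverak2011, proof of Cor. 4.3, sentences 2–4 (arXiv:0911.0500 p. 8), with Cor. 4.2] -/
theorem rusin_sverak_weak_limit_blowup_of_weak_limit_of_singular_points
    (hC : rusin_sverak_weak_limit_of_singular_points) : rusin_sverak_weak_limit_blowup :=
  rusin_sverak_weak_limit_blowup_of_singular_points' rusin_sverak_singular_point_of_blowup_holds hC

/-- **Rusin–Šverák, Cor. 4.3, second clause (`rusin_sverak_minimal_data_compact`: the set of
minimal blow-up data is compact modulo scalings and translations) from Cor. 4.2 alone** (N
discharged). [cite: RusinSverak2011, Cor. 4.3 and its proof (arXiv:0911.0500 p. 8)] -/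
theorem rusin_sverak_minimal_data_compact_of_weak_limit_of_singular_points
    (hC : rusin_sverak_weak_limit_of_singular_points) : rusin_sverak_minimal_data_compact :=
  rusin_sverak_minimal_data_compact_of_singular_points' rusin_sverak_singular_point_of_blowup_holds hC

/-- **Rusin–Šverák, Cor. 4.3, first clause (`rusin_sverak_minimal_blowup`: if `ρ_max < ∞` there
is a weakly divergence-free `Ḣ^{1/2}` datum of norm exactly `ρ_max` without a global Kato
solution) from Cor. 4.2 alone** (N discharged): the printed proof (p. 8) takes blow-up data with
`‖u₀^k‖ → ρ_max`, normalises them so that `T_max = 1` with a singular point at `(0, 1)` (**N** and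
scaling), passes to a weak `Ḣ^{1/2}` limit `v₀`, gets `T_max(v₀) ≤ 1` from Cor. 4.2 (**C**) and
`‖v₀‖ = ρ_max` from weak lower semicontinuity and the definition of `ρ_max`; everything but **C**
is proved in the tree (`rusin_sverak_minimal_blowup_of_singular_points'`,
`rusin_sverak_singular_point_of_blowup_holds`). The discharge `rusin_sverak_minimal_blowup_holds` is
this theorem applied to `rusin_sverak_weak_limit_of_singular_points_holds` once it exists.
[cite: RusinSverak2011, Cor. 4.3, first clause, and its proof (arXiv:0911.0500 p. 8)] -/
theorem rusin_sverak_minimal_blowup_of_weak_limit_of_singular_points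
    (hC : rusin_sverak_weak_limit_of_singular_points) : rusin_sverak_minimal_blowup :=
  rusin_sverak_minimal_blowup_of_singular_points' rusin_sverak_singular_point_of_blowup_holds hC

/-! ## Cor. 4.3 over the five live leaves -/

/-- **Rusin–Šverák's weak-limit blow-up (`rusin_sverak_weak_limit_blowup`) over the five live
leaves** F2, U, J2, J8, Lim; corrected form of `rusin_sverak_weak_limit_blowup_of_five_leaves`
(**U** for the refuted **U₁**).
[cite: RusinSverak2011, proof of Cor. 4.3, sentences 2–4 (arXiv:0911.0500 p. 8), with Cor. 4.2 and §4 p. 6] -/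
theorem rusin_sverak_weak_limit_blowup_of_five_leaves'
    (hF2 : localEnergySolution_extension_of_memE2) (hU : local_leray_weak_strong_uniqueness)
    (hJ2 : jia_sverak_2013_lemma_2) (hJ8 : jia_sverak_2013_lemma_8)
    (hLim : localLeray_limit_isLocalLeraySolution) : rusin_sverak_weak_limit_blowup :=
  rusin_sverak_weak_limit_blowup_of_weak_limit_of_singular_points
    (rusin_sverak_weak_limit_of_singular_points_of_five_leaves' hF2 hU hJ2 hJ8 hLim)

/-- **Rusin–Šverák, Cor. 4.3, second clause (`rusin_sverak_minimal_data_compact`) over the five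
live leaves** F2, U, J2, J8, Lim; corrected form of
`rusin_sverak_minimal_data_compact_of_five_leaves` (**U** for the refuted **U₁**).
[cite: RusinSverak2011, Cor. 4.3 and its proof (arXiv:0911.0500 p. 8)] -/
theorem rusin_sverak_minimal_data_compact_of_five_leaves'
    (hF2 : localEnergySolution_extension_of_memE2) (hU : local_leray_weak_strong_uniqueness)
    (hJ2 : jia_sverak_2013_lemma_2) (hJ8 : jia_sverak_2013_lemma_8)
    (hLim : localLeray_limit_isLocalLeraySolution) : rusin_sverak_minimal_data_compact :=
  rusin_sverak_minimal_data_compact_of_weak_limit_of_singular_points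
    (rusin_sverak_weak_limit_of_singular_points_of_five_leaves' hF2 hU hJ2 hJ8 hLim)

/-- **Rusin–Šverák, Cor. 4.3, first clause (`rusin_sverak_minimal_blowup`) over the five live
leaves** F2, U, J2, J8, Lim — the complete trust base of the minimal-blow-up-datum theorem in the
tree after the refutation of **U₁**; corrected form of `rusin_sverak_minimal_blowup_of_five_leaves`.
The discharge `rusin_sverak_minimal_blowup_holds` is this theorem applied to the five leaf
discharges once they exist. [cite: RusinSverak2011, Cor. 4.3, first clause (arXiv:0911.0500 p. 8)] -/
theorem rusin_sverak_minimal_blowup_of_five_leaves'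
    (hF2 : localEnergySolution_extension_of_memE2) (hU : local_leray_weak_strong_uniqueness)
    (hJ2 : jia_sverak_2013_lemma_2) (hJ8 : jia_sverak_2013_lemma_8)
    (hLim : localLeray_limit_isLocalLeraySolution) : rusin_sverak_minimal_blowup :=
  rusin_sverak_minimal_blowup_of_weak_limit_of_singular_points
    (rusin_sverak_weak_limit_of_singular_points_of_five_leaves' hF2 hU hJ2 hJ8 hLim)

end Literature.Analysis.FluidPDE

end
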